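import Mathlib.AlgebraicGeometry.EllipticCurve.Affine.Point
import Mathlib.RingTheory.DedekindDomain.Dvr
import Mathlib.RingTheory.DiscreteValuationRing.TFAE
import Mathlib.RingTheory.Ideal.GoingUp
import Mathlib.Algebra.Polynomial.Derivative
import HarnessLib

/-!
# The coordinate ring of a smooth Weierstrass cubic is a Dedekind domain

For a field `K` and a Weierstrass curve `W` over `K` with `Δ ≠ 0` (in particular for
`[W.IsElliptic]`), the affine coordinate ring `K[W] = K[X, Y]/(W(X, Y))`
(Mathlib's `WeierstrassCurve.Affine.CoordinateRing`) is a Dedekind domain: it is a Noetherian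
domain of Krull dimension one (finite free of rank `2` over `K[X]`), and its localization at every
maximal ideal `𝔪` is a discrete valuation ring because the closed point `𝔪` is a smooth point of
the plane curve `W = 0`.

This is the algebraic form of Silverman, *The Arithmetic of Elliptic Curves*, Prop. II.1.1
("`K̄[C]_P` is a discrete valuation ring at a smooth point `P`", proved there over `K̄` from
`dim M_P/M_P² = 1`), here over an arbitrary base field `K` and at an arbitrary closed point (maximal
ideal, residue field a finite extension of `K`, possibly inseparable); cf. Liu, *Algebraic
Geometry and Arithmetic Curves*, §4.2–4.3 (Jacobian criterion; smooth ⇒ regular). It is the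
input for the place theory of the elliptic function field `K(W) = Frac K[W]`
(`Literature.NumberTheory.DiophantineGeometry.FunctionFieldGenus`, fact
`genus_functionField_weierstrass`).

## Proof (elementary, by an explicit local parameter)

Let `𝔪 ⊂ R = K[W]` be maximal, `𝔪 ∩ K[X] = (p)` with `p` irreducible, `L = R/𝔪`, and `α, β ∈ L`
the classes of `x, y`.
* If `β = s(α)` for some `s ∈ K[X]` then `𝔪 = (p(x), y - s(x))` (`eq_span_pair_of_mem`). Taylor
  expansion of the Weierstrass polynomial at `Y = s` gives, in `R`,
  `(y - s)² + v(x)(y - s) + g(x) = 0` with `v = 2s + a₁X + a₃ = W_Y(X, s)` and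
  `g = W(X, s) = p·u`. If `v(x) ∉ 𝔪` then `y - s ∈ p·R_𝔪`; if `v(x) ∈ 𝔪` then smoothness of the
  `L`-point `(α, β)` (Mathlib `equation_iff_nonsingular_of_Δ_ne_zero` over `L`) forces
  `u(x) ∉ 𝔪` (differentiate `g = pu`: `g' = s'·v + W_X(X, s)`), so `p ∈ (y - s)·R_𝔪`. Either way
  `𝔪R_𝔪` is principal.
* Otherwise `𝔪 = p·R` is already principal (`eq_span_singleton_of_forall_not_mem`).
A Noetherian local domain which is not a field and whose maximal ideal is principal is a DVR
(Mathlib `IsDiscreteValuationRing.TFAE`), and a Noetherian domain of dimension `≤ 1` all of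
whose localizations at nonzero primes are DVRs is Dedekind (Mathlib `IsDedekindDomainDvr`).

## Main results (namespace `Literature.WeierstrassCoordinateRing`)

* instances `Module.Finite K[X] K[W]`, `Module.Free K[X] K[W]`, `Ring.DimensionLEOne K[W]`
  (any commutative ring resp. any field `K`; not in Mathlib, checked by failing `inferInstance`);
* `isDiscreteValuationRing_localization` : `Δ ≠ 0` ⇒ `R_𝔪` is a DVR for every maximal `𝔪`;
* `isDedekindDomain_of_Δ_ne_zero`, and the instance `IsDedekindDomain W.CoordinateRing` under
  `[W.IsElliptic]`.

## References

* J. H. Silverman, *The Arithmetic of Elliptic Curves*, 2nd ed., GTM 106, Prop. II.1.1, Prop. III.3.1.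
* Q. Liu, *Algebraic Geometry and Arithmetic Curves*, OUP 2002, §4.2 (Thm. 4.2.19), §4.3.
-/

noncomputable section

open Polynomial
open scoped Polynomial.Bivariate

namespace Literature.NumberTheory.EllipticCurves.WeierstrassCoordinateRing

universe u

section General

variable {K : Type u} [CommRing K] (W : WeierstrassCurve.Affine K)

/-- `K[W]` is a finite `K[X]`-module (free of rank two on `1, y`, Mathlib
`WeierstrassCurve.Affine.CoordinateRing.basis`). No such instance exists in Mathlib
(`inferInstance` fails), so nothing is overridden. [folklore] -/
instance instModuleFinite : Module.Finite K[X] W.CoordinateRing :=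
  Module.Finite.of_basis (WeierstrassCurve.Affine.CoordinateRing.basis W)

/-- `K[W]` is a free `K[X]`-module (basis `1, y`). [folklore] -/
instance instModuleFree : Module.Free K[X] W.CoordinateRing :=
  Module.Free.of_basis (WeierstrassCurve.Affine.CoordinateRing.basis W)

end General

variable {K : Type u} [Field K] (W : WeierstrassCurve.Affine K)

/-- `K[W]` has Krull dimension `≤ 1`: it is an integral extension of the principal ideal domain
`K[X]` (Mathlib `Ring.DimensionLEOne.of_isIntegral`). [folklore] -/
instance instDimensionLEOne : Ring.DimensionLEOne W.CoordinateRing :=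
  Ring.DimensionLEOne.of_isIntegral K[X] _

/-- The structure map `K[X] → K[W]` is injective (`1, y` is a `K[X]`-basis). [folklore] -/
theorem algebraMap_injective : Function.Injective (algebraMap K[X] W.CoordinateRing) := by
  intro a b h
  have h0 : (a - b) • (1 : W.CoordinateRing) + (0 : K[X]) • WeierstrassCurve.Affine.CoordinateRing.mk W Y
      = 0 := by
    rw [zero_smul, add_zero, Algebra.smul_def, mul_one, map_sub, h, sub_self]
  exact sub_eq_zero.1 (WeierstrassCurve.Affine.CoordinateRing.smul_basis_eq_zero h0).1

/-- `K[W]` is not a field (it is an integral extension of `K[X]`, which is not a field). [folklore] -/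
theorem not_isField : ¬ IsField W.CoordinateRing := fun h ↦
  Polynomial.not_isField K <|
    isField_of_isIntegral_of_isField (R := K[X]) (S := W.CoordinateRing) (algebraMap_injective W) h

/-- A maximal ideal of `K[W]` is nonzero. [folklore] -/
theorem ne_bot_of_isMaximal (m : Ideal W.CoordinateRing) [hm : m.IsMaximal] : m ≠ ⊥ :=
  Ring.ne_bot_of_isMaximal_of_not_isField hm (not_isField W)

section MaximalIdeal

variable {W}
variable (m : Ideal W.CoordinateRing)

/- Local notation: `cR h = h(x) ∈ K[W]` (the structure map `K[X] → K[W]`, i.e. `mk (C h)`) and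
`yR = y ∈ K[W]`. -/
local notation "cR" => algebraMap K[X] (WeierstrassCurve.Affine.CoordinateRing W)
local notation "yR" => WeierstrassCurve.Affine.CoordinateRing.mk W Y

/-- `h(x) = mk (C h)`. [folklore] -/
theorem algebraMap_eq_mk (h : K[X]) : cR h = WeierstrassCurve.Affine.CoordinateRing.mk W (C h) :=
  rfl

/-- Every element of `K[W]` is `a(x) + b(x) y` (Mathlib `exists_smul_basis_eq`). [folklore] -/
theorem exists_eq_add_mul_y (r : W.CoordinateRing) : ∃ a b : K[X], r = cR a + cR b * yR := by
  obtain ⟨a, b, rfl⟩ := WeierstrassCurve.Affine.CoordinateRing.exists_smul_basis_eq r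
  exact ⟨a, b, by rw [Algebra.smul_def, Algebra.smul_def, mul_one]⟩

/-- The contraction `𝔪 ∩ K[X]` of an ideal of `K[W]`; for `𝔪` maximal it is a maximal ideal of
`K[X]` because `K[W]/K[X]` is integral (Mathlib `Ideal.isMaximal_comap_of_isIntegral_of_isMaximal`).
[folklore] -/
abbrev contraction : Ideal K[X] := m.comap (algebraMap K[X] W.CoordinateRing)

/-- A generator `p` of the principal ideal `𝔪 ∩ K[X] = (p)` of `K[X]`
(`Submodule.IsPrincipal.generator`). [folklore] -/
def gen : K[X] := Submodule.IsPrincipal.generator (contraction m)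

/-- `𝔪 ∩ K[X] = (p)`. [folklore] -/
theorem span_gen : Ideal.span {gen m} = contraction m :=
  Ideal.span_singleton_generator _

/-- `h(x) ∈ 𝔪 ↔ p ∣ h`. [folklore] -/
theorem cR_mem_iff (h : K[X]) : cR h ∈ m ↔ gen m ∣ h := by
  rw [← Ideal.mem_span_singleton, span_gen]; rfl

/-- `p(x) ∈ 𝔪`. [folklore] -/
theorem cR_gen_mem : cR (gen m) ∈ m := (cR_mem_iff m _).2 dvd_rfl

variable [hm : m.IsMaximal]

/-- `𝔪 ∩ K[X]` is maximal for `𝔪` maximal. [folklore] -/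
instance contraction_isMaximal : (contraction m).IsMaximal :=
  Ideal.isMaximal_comap_of_isIntegral_of_isMaximal m

/-- `p ≠ 0` (a maximal ideal of `K[X]` is nonzero). [folklore] -/
theorem gen_ne_zero : gen m ≠ 0 := by
  intro h
  have hbot : contraction m = ⊥ := by rw [← span_gen, h, Ideal.span_singleton_zero]
  exact Ring.ne_bot_of_isMaximal_of_not_isField inferInstance (Polynomial.not_isField K) hbot

/-- `p` is irreducible (it generates a maximal, hence prime, nonzero ideal of `K[X]`). [folklore] -/
theorem irreducible_gen : Irreducible (gen m) := by
  have hprime : Prime (gen m) := by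
    rw [← Ideal.span_singleton_prime (gen_ne_zero m), span_gen]
    infer_instance
  exact hprime.irreducible

omit hm in
/-- **Split closed points.** If the class of `y` in `K[W]/𝔪` lies in the image of `K[X]`, say
`y ≡ s(x) (mod 𝔪)`, then `𝔪 = (p(x), y - s(x))`. Proof: for `r = a(x) + b(x)y ∈ 𝔪` one has
`r = (a + bs)(x) + b(x)(y - s(x))` and `(a + bs)(x) ∈ 𝔪 ∩ K[X] = (p)`. [folklore] -/
theorem eq_span_pair_of_mem {s : K[X]} (hs : yR - cR s ∈ m) :
    m = Ideal.span {cR (gen m), yR - cR s} := by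
  refine le_antisymm (fun r hr ↦ ?_) ?_
  · obtain ⟨a, b, rfl⟩ := exists_eq_add_mul_y r
    have hc : cR (a + b * s) ∈ m := by
      have : cR (a + b * s) = (cR a + cR b * yR) - cR b * (yR - cR s) := by
        simp only [map_add, map_mul]; ring
      rw [this]
      exact m.sub_mem hr (m.mul_mem_left _ hs)
    obtain ⟨c, hc⟩ := (cR_mem_iff m _).1 hc
    have : cR a + cR b * yR = cR c * cR (gen m) + cR b * (yR - cR s) := by
      have h1 : cR a = cR (gen m) * cR c - cR b * cR s := by
        rw [← map_mul, ← hc, map_add, map_mul]; ring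
      rw [h1]; ring
    rw [this]
    exact Ideal.add_mem _ (Ideal.mul_mem_left _ _ (Ideal.subset_span (by simp)))
      (Ideal.mul_mem_left _ _ (Ideal.subset_span (by simp)))
  · rw [Ideal.span_le]
    rintro r (rfl | rfl)
    · exact cR_gen_mem m
    · exact hs

/-- **Non-split closed points.** If the class of `y` in `K[W]/𝔪` is not in the image of `K[X]`,
then `𝔪 = p(x)·K[W]` is principal. Proof: for `r = a(x) + b(x)y ∈ 𝔪`, if `p ∤ b` then `b(x)` is
invertible modulo `𝔪` (Bezout in `K[X]`) and `y ≡ -a(x)b(x)⁻¹`, a contradiction; so `p ∣ b`, then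
`p ∣ a`. [folklore] -/
theorem eq_span_singleton_of_forall_not_mem (hns : ∀ s : K[X], yR - cR s ∉ m) :
    m = Ideal.span {cR (gen m)} := by
  refine le_antisymm (fun r hr ↦ ?_) ?_
  · obtain ⟨a, b, rfl⟩ := exists_eq_add_mul_y r
    have hb : gen m ∣ b := by
      by_contra hnd
      obtain ⟨c, d, hcd⟩ := (irreducible_gen m).coprime_iff_not_dvd.2 hnd
      -- `d(x) b(x) ≡ 1`, so `y ≡ -(a d)(x)`.
      apply hns (-(a * d))
      have key : yR - cR (-(a * d)) =
          cR d * (cR a + cR b * yR) + (1 - cR (c * gen m + d * b)) * yR + cR c * cR (gen m) * yR := by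
        simp only [map_add, map_mul, map_neg]; ring
      rw [key, hcd, map_one, sub_self, zero_mul, add_zero]
      exact m.add_mem (m.mul_mem_left _ hr)
        (m.mul_mem_right _ (m.mul_mem_left _ (cR_gen_mem m)))
    obtain ⟨b', rfl⟩ := hb
    have ha : gen m ∣ a := by
      rw [← cR_mem_iff]
      have : cR a = (cR a + cR (gen m * b') * yR) - cR b' * yR * cR (gen m) := by
        simp only [map_mul]; ring
      rw [this]
      exact m.sub_mem hr (m.mul_mem_left _ (cR_gen_mem m))
    obtain ⟨a', rfl⟩ := ha
    have : cR (gen m * a') + cR (gen m * b') * yR = (cR a' + cR b' * yR) * cR (gen m) := by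
      simp only [map_mul]; ring
    rw [this]
    exact Ideal.mul_mem_left _ _ (Ideal.subset_span rfl)
  · rw [Ideal.span_le, Set.singleton_subset_iff]
    exact cR_gen_mem m


/-! ### Taylor expansion of the Weierstrass polynomial at `Y = s(X)` -/

omit hm

variable (W) in
/-- `A = a₁X + a₃ ∈ K[X]`, the coefficient of `Y` in `W(X, Y) = Y² + A·Y - B`. [folklore] -/
def linA : K[X] := C W.a₁ * X + C W.a₃

variable (W) in
/-- `B = X³ + a₂X² + a₄X + a₆ ∈ K[X]`, so that `W(X, Y) = Y² + A·Y - B`. [folklore] -/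
def cubB : K[X] := X ^ 3 + C W.a₂ * X ^ 2 + C W.a₄ * X + C W.a₆

variable (W) in
/-- `v = W_Y(X, s) = 2s + a₁X + a₃`, the linear Taylor coefficient of `W(X, Y)` at `Y = s`.
[folklore] -/
def taylorV (s : K[X]) : K[X] := 2 * s + linA W

variable (W) in
/-- `g = W(X, s(X)) = s² + (a₁X + a₃)s - (X³ + a₂X² + a₄X + a₆)`, the constant Taylor coefficient of
`W(X, Y)` at `Y = s`. [folklore] -/
def taylorG (s : K[X]) : K[X] := s ^ 2 + linA W * s - cubB W

variable (W) in
/-- `W_X(X, s(X)) = a₁ s - (3X² + 2a₂X + a₄)` (Mathlib's `polynomialX` at `Y = s`). [folklore] -/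
def taylorGX (s : K[X]) : K[X] := C W.a₁ * s - (C 3 * X ^ 2 + C (2 * W.a₂) * X + C W.a₄)

/-- Taylor expansion: `W(X, Y) = (Y - s)² + v·(Y - s) + g` in `K[X][Y]`. [folklore] -/
theorem polynomial_eq_taylor (s : K[X]) : W.polynomial =
    (Y - C s) ^ 2 + C (taylorV W s) * (Y - C s) + C (taylorG W s) := by
  simp only [WeierstrassCurve.Affine.polynomial, taylorV, taylorG, linA, cubB, map_add, map_sub,
    map_mul, map_pow, map_ofNat]
  ring

/-- `W_Y = 2(Y - s) + v` in `K[X][Y]`. [folklore] -/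
theorem polynomialY_eq_taylor (s : K[X]) :
    W.polynomialY = 2 * (Y - C s) + C (taylorV W s) := by
  simp only [WeierstrassCurve.Affine.polynomialY, taylorV, linA, map_add, map_mul, map_ofNat]
  ring

/-- `W_X = a₁(Y - s) + W_X(X, s)` in `K[X][Y]`. [folklore] -/
theorem polynomialX_eq_taylor (s : K[X]) :
    W.polynomialX = C (C W.a₁) * (Y - C s) + C (taylorGX W s) := by
  simp only [WeierstrassCurve.Affine.polynomialX, taylorGX, map_add, map_sub, map_mul, map_pow,
    map_ofNat]
  ring

/-- Chain rule for `g(X) = W(X, s(X))`: `g' = s'·W_Y(X, s) + W_X(X, s)`. [folklore] -/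
theorem derivative_taylorG (s : K[X]) :
    derivative (taylorG W s) = derivative s * taylorV W s + taylorGX W s := by
  simp only [taylorG, taylorV, taylorGX, linA, cubB, derivative_add, derivative_sub,
    derivative_mul, derivative_sq, derivative_X_pow, derivative_X, derivative_C, map_ofNat,
    map_mul]
  simp only [Nat.cast_ofNat, map_ofNat]
  ring

/-- The Taylor identity in `K[W]`: `(y - s(x))² + v(x)(y - s(x)) + g(x) = 0`. [folklore] -/
theorem taylor_identity (s : K[X]) :
    (yR - cR s) ^ 2 + cR (taylorV W s) * (yR - cR s) + cR (taylorG W s) = 0 := by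
  have h := congrArg (WeierstrassCurve.Affine.CoordinateRing.mk W) (polynomial_eq_taylor (W := W) s)
  rw [AdjoinRoot.mk_self] at h
  simp only [map_add, map_mul, map_pow, map_sub, AdjoinRoot.mk_C] at h
  simpa only [algebraMap_eq_mk, AdjoinRoot.mk_C] using h.symm

/-- `W_Y(x, y) = 2(y - s(x)) + v(x)` in `K[W]`. [folklore] -/
theorem mk_polynomialY (s : K[X]) : WeierstrassCurve.Affine.CoordinateRing.mk W W.polynomialY =
    2 * (yR - cR s) + cR (taylorV W s) := by
  rw [polynomialY_eq_taylor s]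
  simp only [map_add, map_mul, map_sub, map_ofNat, AdjoinRoot.mk_C, algebraMap_eq_mk]

/-- `W_X(x, y) = a₁(y - s(x)) + W_X(X, s)(x)` in `K[W]`. [folklore] -/
theorem mk_polynomialX (s : K[X]) : WeierstrassCurve.Affine.CoordinateRing.mk W W.polynomialX =
    cR (C W.a₁) * (yR - cR s) + cR (taylorGX W s) := by
  rw [polynomialX_eq_taylor s]
  simp only [map_add, map_mul, map_sub, AdjoinRoot.mk_C, algebraMap_eq_mk]

/-- `g(x) ∈ 𝔪` as soon as `y - s(x) ∈ 𝔪` (from the Taylor identity), hence `p ∣ g`. [folklore] -/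
theorem gen_dvd_taylorG {s : K[X]} (hs : yR - cR s ∈ m) : gen m ∣ taylorG W s := by
  rw [← cR_mem_iff]
  have : cR (taylorG W s) = -((yR - cR s) * ((yR - cR s) + cR (taylorV W s))) := by
    rw [eq_neg_iff_add_eq_zero, ← taylor_identity s]; ring
  rw [this]
  exact m.neg_mem (m.mul_mem_right _ hs)

/-! ### The closed point `𝔪` is a smooth point -/

/-- Evaluation of bivariate polynomials at the `L`-point `(α, β) = (x mod 𝔪, y mod 𝔪)`,
`L = K[W]/𝔪`, is reduction modulo `𝔪`. [folklore] -/
theorem evalEval_map_eq (P : K[X][Y]) :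
    Polynomial.evalEval (Ideal.Quotient.mk m (cR X)) (Ideal.Quotient.mk m yR)
        (P.map (mapRingHom (algebraMap K (W.CoordinateRing ⧸ m)))) =
      Ideal.Quotient.mk m (WeierstrassCurve.Affine.CoordinateRing.mk W P) := by
  have hhom : eval₂RingHom (eval₂RingHom (algebraMap K (W.CoordinateRing ⧸ m))
      (Ideal.Quotient.mk m (cR X))) (Ideal.Quotient.mk m yR) =
      (Ideal.Quotient.mk m).comp (WeierstrassCurve.Affine.CoordinateRing.mk W) := by
    refine Polynomial.ringHom_ext' (Polynomial.ringHom_ext' ?_ ?_) ?_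
    · ext c
      simp only [RingHom.coe_comp, Function.comp_apply, coe_eval₂RingHom, eval₂_C, AdjoinRoot.mk_C]
      rw [← Ideal.Quotient.mk_algebraMap, IsScalarTower.algebraMap_apply K K[X] W.CoordinateRing,
        Polynomial.algebraMap_eq]
      rfl
    · simp only [RingHom.coe_comp, Function.comp_apply, coe_eval₂RingHom, eval₂_C, eval₂_X]
      rfl
    · simp only [RingHom.coe_comp, Function.comp_apply, coe_eval₂RingHom, eval₂_X]
  rw [← eval₂_eval₂RingHom_apply]
  exact RingHom.congr_fun hhom P

include hm

/-- The `L`-point `(α, β)` of `W` (`L = K[W]/𝔪`) is nonsingular when `Δ ≠ 0` (Mathlib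
`equation_iff_nonsingular_of_Δ_ne_zero` over `L`): `W_X(x, y) ∉ 𝔪` or `W_Y(x, y) ∉ 𝔪`.
[cite: SilvermanAEC2009, Prop. III.1.4(a)] -/
theorem mk_polynomialX_not_mem_or (hΔ : W.Δ ≠ 0) :
    WeierstrassCurve.Affine.CoordinateRing.mk W W.polynomialX ∉ m ∨
      WeierstrassCurve.Affine.CoordinateRing.mk W W.polynomialY ∉ m := by
  set L := W.CoordinateRing ⧸ m
  set φ := algebraMap K L
  have hΔ' : (W.map φ).Δ ≠ 0 := by
    rw [WeierstrassCurve.map_Δ]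
    exact (map_ne_zero_iff φ (algebraMap K L).injective).2 hΔ
  have heq : (W.map φ).Equation (Ideal.Quotient.mk m (cR X)) (Ideal.Quotient.mk m yR) := by
    rw [WeierstrassCurve.Affine.Equation, WeierstrassCurve.Affine.map_polynomial, evalEval_map_eq,
      AdjoinRoot.mk_self, map_zero]
  have hns := (WeierstrassCurve.Affine.equation_iff_nonsingular_of_Δ_ne_zero hΔ').1 heq
  rw [WeierstrassCurve.Affine.Nonsingular, WeierstrassCurve.Affine.map_polynomialX,
    WeierstrassCurve.Affine.map_polynomialY, evalEval_map_eq, evalEval_map_eq, ne_eq, ne_eq,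
    Ideal.Quotient.eq_zero_iff_mem, Ideal.Quotient.eq_zero_iff_mem] at hns
  exact hns.2

/-- **The regular parameter at a split closed point with `W_Y ∈ 𝔪`.** If `y ≡ s(x)`,
`v(x) = W_Y(X, s)(x) ∈ 𝔪` and `g = W(X, s) = p·u`, then `u(x) ∉ 𝔪` (provided `Δ ≠ 0`).
Otherwise `g' = p'u + pu'` and `g' = s'v + W_X(X, s)` give `W_X(x, y) ∈ 𝔪`, and
`W_Y(x, y) = 2(y - s(x)) + v(x) ∈ 𝔪`, contradicting smoothness of the closed point. [folklore] -/
theorem not_mem_of_taylorG_eq (hΔ : W.Δ ≠ 0) {s u : K[X]} (hs : yR - cR s ∈ m)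
    (hv : cR (taylorV W s) ∈ m) (hu : taylorG W s = gen m * u) : cR u ∉ m := by
  intro hum
  rcases mk_polynomialX_not_mem_or m hΔ with hX | hY
  · apply hX
    rw [mk_polynomialX s]
    refine m.add_mem (m.mul_mem_left _ hs) ?_
    have hGX : taylorGX W s = derivative (taylorG W s) - derivative s * taylorV W s := by
      rw [derivative_taylorG]; ring
    rw [hGX, map_sub, map_mul, hu, derivative_mul, map_add, map_mul, map_mul]
    exact m.sub_mem (m.add_mem (m.mul_mem_left _ hum) (m.mul_mem_right _ (cR_gen_mem m)))
      (m.mul_mem_left _ hv)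
  · apply hY
    rw [mk_polynomialY s]
    exact m.add_mem (m.mul_mem_left _ hs) hv

/-! ### The local ring at `𝔪` is a discrete valuation ring -/

/-- The maximal ideal `𝔪R_𝔪` of the local ring of `K[W]` at a maximal ideal `𝔪` is principal,
generated by `p(x)` or by `y - s(x)` (`Δ ≠ 0`). [folklore] -/
theorem exists_map_eq_span_singleton (hΔ : W.Δ ≠ 0) :
    ∃ ϖ ∈ m, m.map (algebraMap W.CoordinateRing (Localization.AtPrime m)) =
      Ideal.span {algebraMap W.CoordinateRing (Localization.AtPrime m) ϖ} := by
  set Rm := Localization.AtPrime m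
  set ι := algebraMap W.CoordinateRing Rm
  have hunit : ∀ r : W.CoordinateRing, r ∉ m → IsUnit (ι r) := fun r hr ↦
    (IsLocalization.AtPrime.isUnit_to_map_iff Rm m r).2 hr
  by_cases hsplit : ∃ s : K[X], yR - cR s ∈ m
  · obtain ⟨s, hs⟩ := hsplit
    obtain ⟨u, hu⟩ := gen_dvd_taylorG m hs
    have hT := taylor_identity (W := W) s
    rw [hu, map_mul] at hT
    -- `(y-s)((y-s) + v) = -p u` in `R`, mapped to `R_𝔪`.
    have hR : (yR - cR s) * (yR - cR s + cR (taylorV W s)) = -(cR (gen m) * cR u) := by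
      linear_combination hT
    have hT' : ι (yR - cR s) * ι (yR - cR s + cR (taylorV W s)) = -(ι (cR (gen m)) * ι (cR u)) := by
      have := congrArg ι hR
      rwa [map_mul, map_neg, map_mul] at this
    rw [congrArg (Ideal.map ι) (eq_span_pair_of_mem m hs), Ideal.map_span, Set.image_pair]
    by_cases hv : cR (taylorV W s) ∈ m
    · -- generator `y - s(x)`; `u(x)` is a unit
      refine ⟨yR - cR s, hs, ?_⟩
      have huu := hunit _ (not_mem_of_taylorG_eq m hΔ hs hv hu)
      rw [Ideal.span_insert, sup_eq_right, Ideal.span_singleton_le_iff_mem, Ideal.mem_span_singleton']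
      exact ⟨-(ι (yR - cR s + cR (taylorV W s)) * ↑huu.unit⁻¹), by
        linear_combination (-↑huu.unit⁻¹) * hT' + ι (cR (gen m)) * huu.mul_val_inv⟩
    · -- generator `p(x)`; `(y - s) + v` is a unit
      refine ⟨cR (gen m), cR_gen_mem m, ?_⟩
      have hw : yR - cR s + cR (taylorV W s) ∉ m := fun h ↦ hv (by simpa using m.sub_mem h hs)
      have hwu := hunit _ hw
      rw [Ideal.span_insert, sup_eq_left, Ideal.span_singleton_le_iff_mem, Ideal.mem_span_singleton']
      exact ⟨-(ι (cR u) * ↑hwu.unit⁻¹), by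
        linear_combination (-↑hwu.unit⁻¹) * hT' + ι (yR - cR s) * hwu.mul_val_inv⟩
  · push Not at hsplit
    refine ⟨cR (gen m), cR_gen_mem m, ?_⟩
    rw [congrArg (Ideal.map ι) (eq_span_singleton_of_forall_not_mem m hsplit), Ideal.map_span,
      Set.image_singleton]

/-- **Regularity of a smooth Weierstrass cubic at every closed point.** For a Weierstrass curve `W`
over a field `K` with `Δ ≠ 0`, the localization of `K[W]` at any maximal ideal `𝔪` is a discrete
valuation ring (Silverman AEC Prop. II.1.1 for `K̄`-points; here for arbitrary closed points over
any `K`). Proof: `R_𝔪` is a Noetherian local domain, not a field, with principal maximal ideal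
(`exists_map_eq_span_singleton`), hence a DVR (Mathlib `IsDiscreteValuationRing.TFAE`).
[cite: SilvermanAEC2009, Prop. II.1.1] -/
theorem isDiscreteValuationRing_localization (hΔ : W.Δ ≠ 0) :
    IsDiscreteValuationRing (Localization.AtPrime m) := by
  haveI : IsNoetherianRing (Localization.AtPrime m) :=
    IsLocalization.isNoetherianRing m.primeCompl _ inferInstance
  have hnf : ¬ IsField (Localization.AtPrime m) :=
    IsLocalization.AtPrime.not_isField W.CoordinateRing (ne_bot_of_isMaximal W m) _
  refine ((IsDiscreteValuationRing.TFAE (Localization.AtPrime m) hnf).out 0 4).mpr ?_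
  obtain ⟨ϖ, -, hϖ⟩ := exists_map_eq_span_singleton m hΔ
  rw [← Localization.AtPrime.map_eq_maximalIdeal, hϖ]
  exact ⟨⟨_, rfl⟩⟩

end MaximalIdeal


/-! ### `K[W]` is a Dedekind domain -/

/-- `Δ ≠ 0` ⇒ `K[W]` is Noetherian with DVR localizations at all nonzero primes
(`IsDedekindDomainDvr`): a nonzero prime is maximal (dimension `≤ 1`). [folklore] -/
theorem isDedekindDomainDvr (hΔ : W.Δ ≠ 0) : IsDedekindDomainDvr W.CoordinateRing where
  is_dvr_at_nonzero_prime P hP hprime := by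
    haveI : P.IsMaximal := hprime.isMaximal hP
    exact isDiscreteValuationRing_localization P hΔ

/-- **The coordinate ring of a smooth Weierstrass cubic is a Dedekind domain** (`Δ ≠ 0`):
Noetherian, integrally closed, of dimension one — equivalently all local rings at closed points are
discrete valuation rings (Silverman AEC Prop. II.1.1 with Ex. 2.1; Liu §4.3). [cite: SilvermanAEC2009, Prop. II.1.1] -/
theorem isDedekindDomain_of_Δ_ne_zero (hΔ : W.Δ ≠ 0) : IsDedekindDomain W.CoordinateRing :=
  haveI := isDedekindDomainDvr W hΔ
  IsDedekindDomainDvr.isDedekindDomain _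

/-- The coordinate ring `K[E]` of an elliptic curve (`[W.IsElliptic]`, i.e. `Δ` a unit) over a
field is a Dedekind domain. No Mathlib instance of this form exists. [cite: SilvermanAEC2009, Prop. II.1.1] -/
instance instIsDedekindDomain [W.IsElliptic] : IsDedekindDomain W.CoordinateRing :=
  isDedekindDomain_of_Δ_ne_zero W W.isUnit_Δ.ne_zero

end Literature.NumberTheory.EllipticCurves.WeierstrassCoordinateRing
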